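import Summits.CriticalPhenomena.Ising3DConformalLimit.Theses.EnergyNotSigmaSquared
import Literature.Probability.LatticeModels.RegularScales

/-!
# Line `inverse-variance-regular-scales` — checked skeleton for the crux `RungOneAdjacentMerging`
(item stmt-CriticalPhenomena-11262 · route EnergyNotSigmaSquared, rank 5 · crux-plan round 1)

Idea card `Cruxes/RungOneAdjacentMerging/Ideas/inverse-variance-regular-scales.md` (lever merged with
`toward-cone-chebyshev`; triage r1-1/2/3: pass).  Line card: `Lines/inverse-variance-regular-scales.md`.

THE LINE.  Two independent duplicated sourced currents in the free box `Λ_n ⊂ ℤ³` at `β_c(3)`: system 1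
with sources `{0, x}`, system 2 with sources `{e₂, x + e₂}` (`e₂ = Pi.single 1 1`).  For the
Messager–Miracle-Solé chunk `𝔸_k(x)` of the dyadic annulus `Ann(2^k, 2^(k+1))` pointing along the dominant
axis of `x` put `N_k = #(C₁ ∩ C₂ ∩ 𝔸_k)`.  The mean-one statistic `𝐌 = Σ_{k ∈ 𝒦} w_k N_k / 𝔼N_k` with
INVERSE-VARIANCE weights `w_k = t_k / Σ_{j ∈ 𝒦} t_j` — `t_k = (B_{k+1} - B_k)/B_{k+2}` the bubble SHARE of
scale `k`, `B_k = B(2^k) = Σ_{‖z‖∞ ≤ 2^k} G(z)²`, `G = ⟨σ₀σ_z⟩_{β_c}` — vanishes on the disjointness event,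
so Chebyshev gives `P[C₁ ∩ C₂ = ∅] ≤ Var 𝐌 ≤ C₁ / Σ_{k ∈ 𝒦} t_k` along every ADMISSIBLE (doubling,
decay-separated) family `𝒦` of scales `2^(k+4) ≤ ‖x‖∞` (stubs S4, S5), and admissible families carry a
divergent share because `B(β_c) = ∞` on `ℤ³` (stubs S1, S2, S3).  Everything is finite-volume at fixed
`(x, n)`; `n → ∞` acts termwise on finitely many box two-point functions (no infinite-volume sourced
current, no mixing theorem, no ratio regularity of the far point).

Registered stubs (sorried, nothing else is): `stub_bubbleShare_not_summable` (S1, M),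
`stub_doublingHarvest` (S2, L — HARDEST), `stub_doubling_regular` (S3, M), `stub_twoNailChebyshev`
(S4, L), `stub_chunkVariance` (S5, L).  The composition `RungOneAdjacentMerging_of : EnergyNotSigmaSquared.RungOneAdjacentMerging` (no sorry of
its own; logic and arithmetic only) concludes the crux BY NAME, using the five stubs by name — the skeleton IS
the crux proof modulo the registered stubs (D-0027 §3.3 shape).

Disproof used (cdisprove v3 of 2026-08-15T22:47Z, known through the three triage reports — the file is not
mounted on this hub): `rungOneAdjacentMerging_false_without_farX` is honoured at S5 (`Admissible` demands
`2^(k+4) ≤ ‖x‖∞` for every used scale; `_of` takes `R = 2^(K+5)`); the finite-bubble obstruction (`d ≥ 5`,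
Aizenman 1982) is honoured at S1 (the only fuel is `B(β_c(3)) = ∞` + the infrared bound; for a convergent
bubble `Σ t_k < ∞` and the line yields nothing); `not_rungOneAdjacentMerging_eps_zero` / `disjoint_prob_pos`:
no stub claims a finite-stage zero (S4 carries `+ η`, `_of` works for `n ≥ n₀`).  `RungOnePower` (rate form)
is NOT reached: the rate is `C₁ / T(log₂ ‖x‖)`, unquantified.
-/

noncomputable section

namespace Summit.CriticalPhenomena.Ising3DConformalLimit.Cruxes.RungOneAdjacentMerging.InverseVarianceRegularScales

open scoped BigOperators Topology Manifold Classical MeasureTheory ProbabilityTheory Matrix InnerProductSpace ComplexConjugate ContinuousMap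
open Filter Set Function TopologicalSpace MeasureTheory
open Literature.Probability.LatticeModels

/-! ### Vocabulary (transparent definitions, no axioms, no named facts) -/

/-- The bond direction of the adjacent nails `0, e₂` of the crux: `e₂ = Pi.single 1 1`. [folklore] -/
abbrev e₂ : Site 3 := Pi.single 1 1

/-- The infinite-volume critical two-point function `G(z) = ⟨σ₀σ_z⟩^∅_{β_c(3),0}` on `ℤ³` (free state
`twoPointFree`; equal to the plus state at `β_c`, `twoPointPlus_criticalBeta_eq_twoPointFree_holds`).
[folklore] -/
abbrev Gc (z : Site 3) : ℝ := twoPointFree 3 (criticalBeta 3) z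

/-- On-axis values `g(m) = G(m e₀)` (non-increasing in `m`, Messager–Miracle-Solé). [folklore] -/
abbrev gax (m : ℕ) : ℝ := Gc (Pi.single 0 (m : ℤ))

/-- The dyadic bubble `B_k = B(2^k) = Σ_{‖z‖∞ ≤ 2^k} G(z)²` (`bubbleDiagram`, ADC21 Thm 1.3 notation).
[folklore] -/
abbrev dyadicBubble (k : ℕ) : ℝ := bubbleDiagram Gc ((2 : ℝ) ^ k)

/-- The bubble SHARE of scale `k`: `t_k = (B_{k+1} - B_k) / B_{k+2}` — the mass of the dyadic shell
`2^k < ‖z‖∞ ≤ 2^(k+1)` relative to the bubble two scales up (`0 ≤ t_k ≤ 1`). [folklore] -/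
abbrev bubbleShare (k : ℕ) : ℝ := (dyadicBubble (k + 1) - dyadicBubble k) / dyadicBubble (k + 2)

/-- Doubling scale with constant `C₀`: properties P1 and P2 of Aizenman–Duminil-Copin 2021, Def. 5.11
(the fields `p1`, `p2` of the tree's `IsRegularScale Gc c C₀ (2^k)`, verbatim) on `Ann(2^k/2, 4·2^k)`; P3
and P4 of the printed definition are deliberately dropped (triage r1-2 §0.3, r1-3 Note H: not needed, and
P4 fails for several scales after a cliff). [cite: AizenmanDuminilCopinAnnals2021, arXiv:1912.07973 Definition 5.11 (p. 20), P1–P2] -/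
structure IsDoublingScale (C₀ : ℝ) (k : ℕ) : Prop where
  p1 : ∀ u ∈ ann 3 (2 ^ k / 2) (4 * 2 ^ k), ∀ v ∈ ann 3 (2 ^ k / 2) (4 * 2 ^ k), Gc v ≤ C₀ * Gc u
  p2 : ∀ u ∈ ann 3 (2 ^ k / 2) (4 * 2 ^ k), ∀ v ∈ ann 3 (2 ^ k / 2) (4 * 2 ^ k),
    |Gc u - Gc v| ≤ C₀ * ((Site.supNorm (u - v) : ℝ) / Site.supNorm u) * Gc u

/-- An ADMISSIBLE family of scales for the far point `x`: every scale is `≥ 4`, satisfies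
`2^(k+4) ≤ ‖x‖∞` (this is where the crux's `R ≤ ‖x‖` is load-bearing —
`rungOneAdjacentMerging_false_without_farX`), is a `C₀`-doubling scale, and two distinct scales are
`L₀`-separated in index and DECAY-separated on the axis (`g` at the larger scale is at most half of `g`
three scales above the smaller one; decay separation is load-bearing in the cross term — in a flat
stretch the cross ratio is `≈ 2`, triage r1-1 E1). [folklore] -/
structure Admissible (C₀ : ℝ) (L₀ : ℕ) (x : Site 3) (𝒦 : Finset ℕ) : Prop where
  scales : ∀ k ∈ 𝒦, 4 ≤ k ∧ 2 ^ (k + 4) ≤ Site.supNorm x ∧ IsDoublingScale C₀ k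
  separated : ∀ k ∈ 𝒦, ∀ l ∈ 𝒦, k < l → k + L₀ ≤ l ∧ 2 * gax (2 ^ l) ≤ gax (2 ^ (k + 3))

/-- The Messager–Miracle-Solé CHUNK of the dyadic annulus `Ann(2^k, 2^(k+1))` pointing along the signed
dominant axis `(i, sign (x i))` of `x`:
`𝔸_k(x) = {u : 2^k ≤ sign(x i)·u i ≤ 2^(k+1); for j ≠ i, |u j| ≤ 2^(k-2) and (x j ≠ 0 → 1 ≤ sign(x j)·u j)}`.
It has `≥ 8^k/16` points, lies in `Ann(2^k, 2^(k+1))` (and `𝔸_k(x) - e₂ ⊂ Ann(2^k - 1, 2^(k+1) + 1)`),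
and BOTH displacements `u` and `u - e₂` lie in the toward-cone of `x` (in the orthant frame of `x`:
non-negative on every coordinate carrying more than half of `‖x‖∞`, off-axis `ℓ¹`-mass `≤ 2^(k-1) + 1 ≤`
the axial part, `4‖·‖₁ ≤ 2^(k+4) ≤ ‖x‖∞`), so that `G(x - u) ≥ G(x)` and `G(x + e₂ - u) ≥ G(x)` follow
from the Messager–Miracle-Solé inequalities ALONE (axis moves + budgeted diagonal reflections: ADC21
Remark 6.5 footnote, and the triage-verified `TowardConeMonotone` of `SketchIdeator3.lean`).  The sign
condition on non-zero secondary coordinates is load-bearing: for `x = (N, N, 0)` a transverse step against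
`sign (x j)` raises the sup norm and `G(x - u) ≥ G(x)` is no longer an MMS consequence.
[cite: AizenmanDuminilCopinAnnals2021, arXiv:1912.07973 Remark 6.5, footnote (the set 𝔸_y(m), p. 23)] -/
def chunk (i : Fin 3) (x : Site 3) (k : ℕ) : Finset (Site 3) :=
  (box 3 (2 ^ (k + 1))).filter fun u =>
    (2 ^ k : ℤ) ≤ Int.sign (x i) * u i ∧
      ∀ j : Fin 3, j ≠ i → |u j| ≤ 2 ^ (k - 2) ∧ (x j ≠ 0 → 1 ≤ Int.sign (x j) * u j)

/-- One-point density of system 1 (sources `{0, x}`): `P^{0x,∅}[u ∈ C(0)] = G(u)G(x-u)/G(x)`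
(infinite-volume value of the tree's finite-volume identity `tsum_epairWeight_mul_indicator_mem_cluster`).
[cite: AizenmanDuminilCopinAnnals2021, arXiv:1912.07973 §4.2, proof of Lemma 4.4 (first moment)] -/
def dens₁ (x u : Site 3) : ℝ := Gc u * Gc (x - u) / Gc x

/-- One-point density of system 2 (sources `{e₂, x + e₂}`): `G(u-e₂)G(x+e₂-u)/G(x)`.
[cite: AizenmanDuminilCopinAnnals2021, arXiv:1912.07973 §4.2, proof of Lemma 4.4 (first moment)] -/
def dens₂ (x u : Site 3) : ℝ := Gc (u - e₂) * Gc (x + e₂ - u) / Gc x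

/-- Two-step majorant of system 1 (ADC21 Prop. A.3 = the tree's `twoStepBound`, normalised):
`P^{0x,∅}[u, v ∈ C(0)] ≤ (G(u)G(v-u)G(x-v) + G(v)G(v-u)G(x-u)) / G(x)`.
[cite: AizenmanDuminilCopinAnnals2021, arXiv:1912.07973 Appendix A.2, Proposition A.3] -/
def tstep₁ (x u v : Site 3) : ℝ :=
  (Gc u * Gc (v - u) * Gc (x - v) + Gc v * Gc (v - u) * Gc (x - u)) / Gc x

/-- Two-step majorant of system 2 (nail `e₂`, sink `x + e₂`).
[cite: AizenmanDuminilCopinAnnals2021, arXiv:1912.07973 Appendix A.2, Proposition A.3] -/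
def tstep₂ (x u v : Site 3) : ℝ :=
  (Gc (u - e₂) * Gc (v - u) * Gc (x + e₂ - v) + Gc (v - e₂) * Gc (v - u) * Gc (x + e₂ - u)) / Gc x

/-- Limiting first moment of the intersection count of a chunk `A`: `lim_n 𝔼_n N_A = Σ_{u ∈ A} dens₁ dens₂`.
[folklore] -/
def mean (x : Site 3) (A : Finset (Site 3)) : ℝ := ∑ u ∈ A, dens₁ x u * dens₂ x u

/-- Limiting second-moment majorant: `limsup_n 𝔼_n[N_A N_B] ≤ Σ_{u ∈ A, v ∈ B} tstep₁ tstep₂`. [folklore] -/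
def umaj (x : Site 3) (A B : Finset (Site 3)) : ℝ := ∑ u ∈ A, ∑ v ∈ B, tstep₁ x u v * tstep₂ x u v

/-- The Chebyshev functional of a weighted chunk family: the majorant of `𝔼[𝐌²] - 1 = Var 𝐌` for the
mean-one statistic `𝐌 = Σ_k w_k N_{A_k} / 𝔼N_{A_k}` (`Σ_k w_k = 1`). [folklore] -/
def chebFun (x : Site 3) (𝒦 : Finset ℕ) (A : ℕ → Finset (Site 3)) (w : ℕ → ℝ) : ℝ :=
  (∑ k ∈ 𝒦, ∑ l ∈ 𝒦, w k * w l * (umaj x (A k) (A l) / (mean x (A k) * mean x (A l)))) - 1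

/-- INVERSE-VARIANCE weights `w_k = t_k / Σ_{j ∈ 𝒦} t_j` (the lever of the card: the single-shell
variance is `≍ 1/t_k`, so these minimise `Var 𝐌`, giving `Var 𝐌 ≲ 1 / Σ_𝒦 t_k`). [folklore] -/
def ivw (𝒦 : Finset ℕ) (k : ℕ) : ℝ := bubbleShare k / ∑ j ∈ 𝒦, bubbleShare j

/-- The crux's probability, verbatim: in the free box `Λ_n` (nearest-neighbour graph of `ℤ³` induced on
`box 3 n`) at `β_c(3)`, the `P^{oy,∅} ⊗ P^{ay',∅}`-probability that no vertex `u` is joined both to `o`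
in `n₁ + n₃` and to `a` in `n₂ + n₄` (= disjointness of the clusters `C_{n₁+n₃}(o)`, `C_{n₂+n₄}(a)`;
bridge to `Current.cluster`: refuter evidence SketchEquiv.lean / ProbesRungOne.lean). [folklore] -/
def disjProb (n : ℕ) (o a y y' : ↥(box 3 n)) : ℝ :=
  ((doubleCurrentMeasure ((zdGraph 3).comap (Subtype.val : ↥(box 3 n) → Site 3)) (criticalBeta 3)
      (symmDiff {o} {y}) ∅).prod
    (doubleCurrentMeasure ((zdGraph 3).comap (Subtype.val : ↥(box 3 n) → Site 3)) (criticalBeta 3)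
      (symmDiff {a} {y'}) ∅)).real
    {pq | ∀ u : ↥(box 3 n),
      ¬ (pq.1 ∈ tracedConn ((zdGraph 3).comap (Subtype.val : ↥(box 3 n) → Site 3)) o u ∧
        pq.2 ∈ tracedConn ((zdGraph 3).comap (Subtype.val : ↥(box 3 n) → Site 3)) a u)}

/-! ### Registered stubs -/

/-- **S1 (fuel; size M).** The bubble shares are not summable: `Σ_k t_k = ∞`.  From `B_k ↑ ∞`
(`DuminilCopinPanis2025_bubbleDiagram_eq_top_holds`, DCP25 Thm 1.8, over `twoPointFree 3 (criticalBeta 3)`)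
and `B(L) ≤ C L` (infrared bound `G(z) ≤ C/‖z‖`: `criticalTwoPoint_bounds_holds` +
`twoPointPlus_criticalBeta_eq_twoPointFree_holds`): with `r_k = B_{k+1}/B_k`,
`t_k = (r_k - 1)/(r_k r_{k+1})`; maximal runs of `r > 4` are finite (`B_k ≤ C 2^k`) and each run end gives
`t ≥ 3/16`; if runs stop occurring then `Σ (r_k - 1) ≥ Σ log r_k = ∞`.  (The card's
`increment_ratio_not_summable`, checked by triage r1-1.)
[cite: DuminilCopinPanis2025LowerBounds, Theorem 1.8 (with the infrared bound)] -/
theorem stub_bubbleShare_not_summable : ¬ Summable bubbleShare := by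
  sorry

/-- **S2 (HARDEST; size L) — the harvest / selection lemma.** If the shares are not summable, then for
some doubling constant `D ≥ 1`, every index separation `L₀` and every target `A` there is a finite family
`𝒦 ⊆ [4, K]` of AXIS-DOUBLING scales (`g(2^(k-3)) ≤ D g(2^(k+4))`), pairwise `L₀`-separated and
decay-separated (`2 g(2^l) ≤ g(2^(k+3))` for `k < l` in `𝒦`), with `Σ_{k ∈ 𝒦} t_k ≥ A`.  Sketch (triage
r1-1 E5, r1-2 §0.3, r1-3 Note H): `θ_j := log₂ g(2^j)/g(2^(j+1)) ≥ 0`; axis log-convexity (reflection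
positivity, tree `TwoPointLogConvex` / `AxisSpectralRepresentation`, DCP25 footnote 2) gives the ramp
constraint `θ_{j+1} ≤ 2θ_j`, so doubling at `k` follows from the single backward bound `θ_{k-3} ≤ Θ`
(`D = 2^(127Θ)`), and a share-carrying scale has `θ_{k-3} + θ_{k-2} + θ_{k-1} ≤ 4.5 + C(τ)` ("dominance is
self-improving": `b_k ≥ τ B_k` bounds the decay from every earlier scale); shells after a cliff of height
`h` are light (`t ≤ C 2^(12-2h)`) until the shell mass catches up, by which time the scale is doubling
again; one scale per `g`-halving block keeps `Σ = ∞` (`t_last ≥ c·min(1, block share)` since `b` at least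
doubles per scale inside a block and `b_{j+2} ≤ C b_j` always, MMS); pigeonhole over residues mod `L₀`.
[folklore] -/
theorem stub_doublingHarvest :
    ¬ Summable bubbleShare →
    ∃ D : ℝ, 1 ≤ D ∧ ∀ (L₀ : ℕ) (A : ℝ), ∃ K : ℕ, ∃ 𝒦 : Finset ℕ,
      (∀ k ∈ 𝒦, 4 ≤ k ∧ k ≤ K ∧ gax (2 ^ (k - 3)) ≤ D * gax (2 ^ (k + 4))) ∧
      (∀ k ∈ 𝒦, ∀ l ∈ 𝒦, k < l → k + L₀ ≤ l ∧ 2 * gax (2 ^ l) ≤ gax (2 ^ (k + 3))) ∧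
      A ≤ ∑ k ∈ 𝒦, bubbleShare k := by
  sorry

/-- **S3 (size M) — axis doubling gives P1/P2: the `d = 3` re-run of ADC21 Prop. 5.9 / of the P1–P2 part
of the tree's `isRegularScale_of_growth` (d = 4).** P1 on `Ann(2^k/2, 4·2^k)` from the MMS sandwich
`g(‖u‖₁) ≤ G(u) ≤ g(‖u‖∞)` (`messager_miracleSole_free`, `messager_miracleSole_diag_free`; `‖u‖₁ ≤ 3·2^(k+2)
≤ 2^(k+4)`); P2 from the Duminil-Copin–Panis gradient estimate `twoPointFree_criticalBeta_gradient_estimate`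
(d ≥ 3, per-step form `G(z) - G(z + e_j) ≤ G(m e_j)/(z_j - m + 1)`, `m = ⌊3 z_j/4⌋ ≥ 2^(k-3)`) for the
large coordinates, the MMS detour ("Messager–Miracle-Solé applied twice", ADC21 p. 19) for the small ones,
the path lemma `abs_sub_le_mul_l1Dist_of_steps`, and P1 for pairs at distance `≥ ‖u‖/4`.
[cite: AizenmanDuminilCopinAnnals2021, arXiv:1912.07973 Proposition 5.9 and proof of Theorem 5.12 (p. 19–20)] -/
theorem stub_doubling_regular :
    ∀ D : ℝ, 1 ≤ D → ∃ C₀ : ℝ, 1 ≤ C₀ ∧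
      ∀ k : ℕ, 4 ≤ k → gax (2 ^ (k - 3)) ≤ D * gax (2 ^ (k + 4)) → IsDoublingScale C₀ k := by
  sorry

/-- **S4 (size L; provable now) — the two-nail second-moment (Chebyshev) bound, limit form.** For every
far point `x`, every finite weighted family of chunks (weights `≥ 0` summing to one, positive limiting
means) and every `η > 0`: for all large `n` the crux's disjointness probability is at most `chebFun + η`.
Proof: on the finite box graph, `𝔼_n N_A = Σ_{u ∈ A} a₁ⁿ(u) a₂ⁿ(u)` EXACTLY, `aᵢⁿ(u) = Gₙ(sᵢ,u)Gₙ(u,yᵢ)/Gₙ(sᵢ,yᵢ)`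
(switching: `tsum_epairWeight_mul_indicator_mem_cluster`, normalised by `doubleCurrentMeasure_real_mul` and
`isingTwoPoint_free_eq_currentSum_div_holds`; this is what the sourceless partners `n₃, n₄` buy);
`𝔼_n[N_A N_B] ≤ Σ_{u ∈ A, v ∈ B} T₁ⁿ(u,v) T₂ⁿ(u,v)` (Prop. A.3 for each system,
`ecurrentSum_empty_mul_tsum_connInd_mul_connInd_le`, as in `sq_mul_tsum_prodWeight_mul_interCount_sq_le`
but with the two nails `o ≠ a`); the disjointness event is contained in `{𝐌ₙ = 0}` for
`𝐌ₙ = Σ_k w_k N_{A_k}/𝔼_n N_{A_k}`, and `P[𝐌ₙ = 0] ≤ 𝔼(𝐌ₙ - 1)² = 𝔼𝐌ₙ² - 1 ≤ Σ_{k,l} w_k w_l Uⁿ_{kl}/(mⁿ_k mⁿ_l) - 1`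
(product measure is a probability measure: `isProbabilityMeasure_doubleCurrentMeasure_holds`,
`currentSum > 0` on the connected box); finally `n → ∞` on the finitely many box two-point functions
involved (`isingCorr_free_map` transports the induced box graph to `⟨·⟩^∅_{Λ_n}` of `zdGraph 3`,
`tendsto_isingTwoPoint_box_sub`, `G > 0`), which turns `aⁿ, Tⁿ` into `dens, tstep`.
[cite: AizenmanDuminilCopinAnnals2021, arXiv:1912.07973 §4.2 Lemma 4.4 and §6.2 (6.5) (second-moment method), Appendix A.3] -/
theorem stub_twoNailChebyshev :
    ∀ (x : Site 3) (𝒦 : Finset ℕ) (A : ℕ → Finset (Site 3)) (w : ℕ → ℝ),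
      (∀ k ∈ 𝒦, 0 ≤ w k) → ∑ k ∈ 𝒦, w k = 1 → (∀ k ∈ 𝒦, 0 < mean x (A k)) →
      ∀ η : ℝ, 0 < η → ∃ n₀ : ℕ, ∀ n : ℕ, n₀ ≤ n → ∀ o a y y' : ↥(box 3 n),
        (o : Site 3) = 0 → (a : Site 3) = e₂ → (y : Site 3) = x → (y' : Site 3) = x + e₂ →
        disjProb n o a y y' ≤ chebFun x 𝒦 A w + η := by
  sorry

/-- **S5 (size L) — the chunk variance bound: ADC21 (6.5) run for TWO systems with nails `0 ≠ e₂`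
towards MERGING in `d = 3`.** For every doubling constant `C₀` there are `C₁, L₀` such that for every far
point `x`, dominant axis `i` and admissible family `𝒦`, the chunk means are positive and the
inverse-variance Chebyshev functional over the MMS chunks is at most `C₁ / Σ_𝒦 t_k` — uniformly in `x`
and its direction, with NO regularity of `G` at scale `‖x‖`.  Sub-lemmas (line card): (diag) with
`Ḡ_k = G` at scale `k` (P1) and `H = h₁h₂ ≥ 1` on the chunk (`hᵢ` = far tilts, MMS toward-cone;
`h₁ ≍ h₂` by one-step GKS `G(z + e₂) ≥ G(e₂) G(z)`): `umaj_kk ≤ C(C₀) Ḡ_k² B_{k+2} Σ_{𝔸_k} H`,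
`mean_k ≥ c(C₀) Ḡ_k² Σ_{𝔸_k} H`, `|𝔸_k| Ḡ_k² ≥ c(C₀) b_k`, hence `umaj_kk/mean_k² ≤ C/t_k` (where `d = 3`
enters); (cross) for admissible `k < l`: `umaj_kl ≤ (1 + ε_kl)² mean_k mean_l` with
`ε_kl = 4C₀ 2^(k-l) + C₀² 2^(-n_kl)`, `n_kl = #(𝒦 ∩ (k, l])`, from P2 at scale `l` (ADC21 p. 24 (b1)) and
decay separation ((b2)) — only UPPER bounds on `G(s,y)/G(u,y)` enter and these are `≤ 1` on the chunk for
both systems; (sum) with `w_k = t_k/T`: `Σ_k w_k² C/t_k = C/T`,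
`Σ_{k ≠ l} w_k w_l ((1 + ε_kl)² - 1) ≤ C(C₀) max_k w_k ≤ C(C₀)/T` (`t_k ≤ 1`, `Σ_l ε_kl ≤ 4C₀ + C₀²`).
[cite: AizenmanDuminilCopinAnnals2021, arXiv:1912.07973 §6.2, proof of Proposition 6.6 / (6.5), cases ℓ = k and ℓ > k (p. 24)] -/
theorem stub_chunkVariance :
    ∀ C₀ : ℝ, 1 ≤ C₀ → ∃ C₁ : ℝ, ∃ L₀ : ℕ, 0 < C₁ ∧
      ∀ (x : Site 3) (i : Fin 3) (𝒦 : Finset ℕ),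
        (x i).natAbs = Site.supNorm x → Admissible C₀ L₀ x 𝒦 →
        (∀ k ∈ 𝒦, 0 < mean x (chunk i x k)) ∧
        chebFun x 𝒦 (chunk i x) (ivw 𝒦) ≤ C₁ / ∑ k ∈ 𝒦, bubbleShare k := by
  sorry

/-! ### A small proved fact used by the composition -/

/-- `t_k ≥ 0` (`B` is non-decreasing and non-negative). [folklore] -/
theorem bubbleShare_nonneg (k : ℕ) : 0 ≤ bubbleShare k := by
  refine div_nonneg (sub_nonneg.2 ?_) (bubbleDiagram_nonneg _ _)
  exact bubbleDiagram_mono _ (pow_le_pow_right₀ one_le_two (Nat.le_succ k))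

/-! ### The composition: the five stubs imply the crux, by name -/

/-- **Composition (the skeleton IS the crux proof modulo the five registered stubs).** Pure logic and
arithmetic over S1–S5, used BY NAME: S2 (fed by S1) gives `D`; S3 gives `C₀`; S5 gives `C₁, L₀`; for `ε > 0`
take the harvest target `A = max 1 (2C₁/ε)`, the family `𝒦 ⊆ [4, K]` of S2 and `R = 2^(K+5)`; for
`‖x‖ ≥ R` pick a dominant axis `i`, check `Admissible C₀ L₀ x 𝒦`, and apply S4 with `η = ε/2` to the chunk
family with inverse-variance weights: `P ≤ C₁/T + ε/2 ≤ C₁/A + ε/2 ≤ ε` for `n ≥ n₀(x)`.  No `sorry` of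
its own; its only non-whitelisted axiom dependence is through the five stubs. [folklore] -/
theorem RungOneAdjacentMerging_of :
    Summit.CriticalPhenomena.Ising3DConformalLimit.Theses.EnergyNotSigmaSquared.RungOneAdjacentMerging := by
  obtain ⟨D, hD, hH⟩ := stub_doublingHarvest stub_bubbleShare_not_summable
  obtain ⟨C₀, hC₀, hreg⟩ := stub_doubling_regular D hD
  obtain ⟨C₁, L₀, hC₁, hV⟩ := stub_chunkVariance C₀ hC₀
  unfold Summit.CriticalPhenomena.Ising3DConformalLimit.Theses.EnergyNotSigmaSquared.RungOneAdjacentMerging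
  intro ε hε
  -- the harvest target `A` and the admissible family of scales (chosen before `x`)
  set A : ℝ := max 1 (2 * C₁ / ε) with hAdef
  have hA1 : (1 : ℝ) ≤ A := le_max_left _ _
  have hApos : (0 : ℝ) < A := lt_of_lt_of_le one_pos hA1
  have hA2 : 2 * C₁ / ε ≤ A := le_max_right _ _
  obtain ⟨K, 𝒦, hdoub, hsep, hsum⟩ := hH L₀ A
  refine ⟨(2 : ℝ) ^ (K + 5), fun x hx => ?_⟩
  -- a dominant axis of `x`
  obtain ⟨i, -, hi⟩ := Finset.exists_mem_eq_sup (Finset.univ : Finset (Fin 3)) Finset.univ_nonempty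
    (fun j => (x j).natAbs)
  have hxi : (x i).natAbs = Site.supNorm x := by
    unfold Site.supNorm
    exact hi.symm
  -- `‖x‖∞ ≥ 2^(K+5)`
  have hnorm : (2 : ℝ) ^ (K + 5) ≤ (Site.supNorm x : ℝ) := by
    rw [← Site.norm_eq_supNorm]; exact hx
  have hnormN : 2 ^ (K + 5) ≤ Site.supNorm x := by exact_mod_cast hnorm
  -- admissibility of `𝒦` for `x`
  have hadm : Admissible C₀ L₀ x 𝒦 := by
    refine ⟨fun k hk => ?_, hsep⟩
    obtain ⟨hk4, hkK, hkd⟩ := hdoub k hk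
    refine ⟨hk4, ?_, hreg k hk4 hkd⟩
    calc 2 ^ (k + 4) ≤ 2 ^ (K + 5) := Nat.pow_le_pow_right (by norm_num) (by omega)
      _ ≤ Site.supNorm x := hnormN
  obtain ⟨hmean, hcheb⟩ := hV x i 𝒦 hxi hadm
  -- the total share `T ≥ A > 0` and the inverse-variance weights
  set T : ℝ := ∑ k ∈ 𝒦, bubbleShare k with hTdef
  have hT : A ≤ T := hsum
  have hTpos : 0 < T := lt_of_lt_of_le hApos hT
  have hw0 : ∀ k ∈ 𝒦, 0 ≤ ivw 𝒦 k := fun k _ => div_nonneg (bubbleShare_nonneg k) hTpos.le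
  have hw1 : ∑ k ∈ 𝒦, ivw 𝒦 k = 1 := by
    simp only [ivw]
    rw [← Finset.sum_div]
    exact div_self hTpos.ne'
  -- S4: Chebyshev in the box, for all large `n`
  obtain ⟨n₀, hn₀⟩ :=
    stub_twoNailChebyshev x 𝒦 (chunk i x) (ivw 𝒦) hw0 hw1 hmean (ε / 2) (half_pos hε)
  refine ⟨n₀, fun n hn o a y y' ho ha hy hy' => ?_⟩
  have hP := hn₀ n hn o a y y' ho ha hy hy'
  -- `chebFun ≤ C₁/T ≤ C₁/A ≤ ε/2`
  have hTA : C₁ / T ≤ C₁ / A := div_le_div_of_nonneg_left hC₁.le hApos hT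
  have hAε : C₁ / A ≤ ε / 2 := by
    rw [div_le_iff₀ hApos]
    have h' : 2 * C₁ ≤ A * ε := by rwa [div_le_iff₀ hε] at hA2
    linarith
  show disjProb n o a y y' ≤ ε
  linarith [hP, hcheb, hTA, hAε]

end Summit.CriticalPhenomena.Ising3DConformalLimit.Cruxes.RungOneAdjacentMerging.InverseVarianceRegularScales

end
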